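import Literature.Analysis.FluidPDE.TypeIAncientMild
import Summits.NavierStokesRegularity.NavierStokesRegularity.Theorems.MustSqueeze.Negative.GaussianVortex
import HarnessLib

/-!
# Crux `FarPastLedger` (stmt-NavierStokesRegularity-14060, route SymmetryModuliCount), negative side: the trivial regime and the load-bearing hypotheses

Negative-side (cdisprove, D-0016) support lemmas extracted from the crux work file
`Cruxes/FarPastLedger/Disproof.lean` v1 so that ideators / planners / provers can IMPORT them.
The crux reads `∀ C ∃ K ∀ u, IsTypeIAncientMild C u → ∀ t<0 ∀ x₀ ∀ R>0, ∫_{B_R(x₀)} ‖u t x‖² ≤ K·R`.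

* `ledger_parabolic_interior` — the TRIVIAL REGIME: for `R² ≤ −t` the bound holds with `K = C²V₁`
  from the Type-I rate alone (the content of the crux is `R ≫ √(−t)`);
* `farPastLedger_false_without_mild` — the Oseen/KNSS mild clause deleted ⇒ the ledger is FALSE
  (parasitic `par t = (1−t)⁻¹e₀`: smooth, div-free, Type-I with `C = 1`, energy `R³V₁/4` at `t = −1`);
* `farPastLedger_false_without_typeI` — the Type-I rate weakened to boundedness (KNSS's bounded
  ancient mild class) ⇒ FALSE (constants are KNSS-mild, energy `R³V₁`);
* `farPastLedger_false_on_window` — ancientness deleted (the same class on the final window `(−1,0)`,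
  Type-I rate kept) ⇒ FALSE at `C = 1` (constants): the far past is load-bearing, which is exactly the
  setting of AlbrittonBarker2019 Rem. 3.2.

No statement of the route is changed; nothing here closes the item (`--supports`).
-/

noncomputable section

namespace Summit.NavierStokesRegularity.NavierStokesRegularity.Theorems.FarPastLedger.Negative

open MeasureTheory Set Filter Metric
open scoped Topology
open Literature.Analysis.FluidPDE Literature.Analysis.UnboundedOperators
open Summit.NavierStokesRegularity.NavierStokesRegularity.Theorems.MustSqueeze.Negative (e0 V1 V1_nonneg
  volume_ball_toReal)

local notation "ℝ³" => EuclideanSpace ℝ (Fin 3)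

/-! ## Two measure-theoretic one-liners -/

/-- `0 < V₁ = |B₁|`. -/
theorem V1_pos : 0 < V1 :=
  ENNReal.toReal_pos (measure_ball_pos volume (0 : ℝ³) one_pos).ne' measure_ball_lt_top.ne

/-- `∫_{B_R(x₀)} c = c · R³ V₁`. -/
theorem setIntegral_ball_const (x₀ : ℝ³) {R : ℝ} (hR : 0 < R) (c : ℝ) :
    ∫ _x in ball x₀ R, c = c * (R ^ 3 * V1) := by
  rw [setIntegral_const, smul_eq_mul, measureReal_def, volume_ball_toReal x₀ hR, mul_comm]

/-! ## The trivial regime: the parabolic interior `R² ≤ −t` -/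

/-- Pointwise Type-I bound integrated: `∫_{B_R(x₀)} |u(t)|² ≤ C²/(−t) · R³ V₁`. -/
theorem setIntegral_ball_le_typeI {C : ℝ} {u : ℝ → ℝ³ → ℝ³} (h : IsTypeIAncientMild C u) {t : ℝ}
    (ht : t < 0) (x₀ : ℝ³) {R : ℝ} (hR : 0 < R) :
    ∫ x in ball x₀ R, ‖u t x‖ ^ 2 ≤ C ^ 2 / (-t) * (R ^ 3 * V1) := by
  have hpt : ∀ x, ‖u t x‖ ^ 2 ≤ C ^ 2 / (-t) := fun x => by
    have h1 := h.norm_le ht x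
    have h2 : (C / Real.sqrt (-t)) ^ 2 = C ^ 2 / (-t) := by
      rw [div_pow, Real.sq_sqrt (by linarith)]
    rw [← h2]
    exact pow_le_pow_left₀ (norm_nonneg _) h1 2
  calc ∫ x in ball x₀ R, ‖u t x‖ ^ 2 ≤ ∫ _x in ball x₀ R, C ^ 2 / (-t) :=
        integral_mono_of_nonneg (Eventually.of_forall fun x => by positivity)
          (integrableOn_const measure_ball_lt_top.ne) (Eventually.of_forall hpt)
    _ = C ^ 2 / (-t) * (R ^ 3 * V1) := setIntegral_ball_const x₀ hR _

/-- **The ledger holds at the Leray rate inside the parabolic interior** `R² ≤ −t`, with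
`K = C² V₁`, from the Type-I bound alone. -/
theorem ledger_parabolic_interior {C : ℝ} {u : ℝ → ℝ³ → ℝ³} (h : IsTypeIAncientMild C u) {t : ℝ}
    (ht : t < 0) (x₀ : ℝ³) {R : ℝ} (hR : 0 < R) (hRt : R ^ 2 ≤ -t) :
    ∫ x in ball x₀ R, ‖u t x‖ ^ 2 ≤ (C ^ 2 * V1) * R := by
  refine (setIntegral_ball_le_typeI h ht x₀ hR).trans ?_
  have ht' : 0 < -t := by linarith
  have hq : R ^ 2 / (-t) ≤ 1 := (div_le_one ht').2 hRt
  have hnn : 0 ≤ C ^ 2 * V1 * R := by have := V1_nonneg; positivity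
  calc C ^ 2 / (-t) * (R ^ 3 * V1) = C ^ 2 * V1 * R * (R ^ 2 / (-t)) := by
        field_simp
    _ ≤ C ^ 2 * V1 * R * 1 := by gcongr
    _ = C ^ 2 * V1 * R := mul_one _

/-! ## Load-bearing hypotheses (any proof must use them) -/

/-- `‖e₀‖ = 1`. -/
theorem norm_e0 : ‖(e0 : ℝ³)‖ = 1 := by simp [e0]

/-! ### The Oseen/KNSS mild clause (3): parasitic `b(t) = (1−t)⁻¹ e₀` -/

/-- The parasitic field `par t x = (1 − t)⁻¹ e₀` (KNSS 2009 §1 p. 3: `u = b(t)`, `p = −b'(t)·x`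
solves NS classically but is not mild). -/
def par : ℝ → ℝ³ → ℝ³ := fun t _ => (1 - t)⁻¹ • e0

/-- `par` is smooth on the open slab `t < 0`. -/
theorem par_smooth : ContDiffOn ℝ (⊤ : ℕ∞) (Function.uncurry par) (Iio 0 ×ˢ univ) := by
  have e : Function.uncurry par = fun p : ℝ × ℝ³ => (1 - p.1)⁻¹ • (e0 : ℝ³) := rfl
  rw [e]
  refine ContDiffOn.smul ((contDiffOn_const.sub contDiffOn_fst).inv fun p hp => ?_) contDiffOn_const
  have : p.1 < 0 := hp.1
  exact ne_of_gt (by linarith)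

/-- `par` has divergence-free (constant) slices. -/
theorem par_divFree (t : ℝ) : VectorCalculus.IsDivFree (par t) := fun x => by
  rw [show par t = fun _ => (1 - t)⁻¹ • (e0 : ℝ³) from rfl]
  simp [VectorCalculus.divergence]

/-- `par` obeys the Type-I rate with `C = 1`: `(1−t)⁻¹ ≤ 1/√(−t)`. -/
theorem par_typeI : HasTypeITimeDecay 1 par := by
  intro t ht x
  have h1 : 0 < 1 - t := by linarith
  have hs : 0 < Real.sqrt (-t) := Real.sqrt_pos.2 (by linarith)
  have hsq : Real.sqrt (-t) ≤ 1 - t := Real.sqrt_le_iff.2 ⟨h1.le, by nlinarith⟩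
  simp only [par, norm_smul, norm_inv, Real.norm_of_nonneg h1.le, norm_e0, mul_one, one_div]
  exact inv_anti₀ hs hsq

/-- At `t = −1` the parasitic field has energy `R³V₁/4` in `B_R`, beating `K·R` for large `R`. -/
theorem par_energy_gt (K : ℝ) : ∃ R, 0 < R ∧ K * R < ∫ x in ball (0 : ℝ³) R, ‖par (-1) x‖ ^ 2 := by
  have hV := V1_pos
  set R : ℝ := 4 * |K| / V1 + 1 with hR
  have hRpos : 0 < R := by positivity
  have hR1 : 1 ≤ R := by
    have : 0 ≤ 4 * |K| / V1 := by positivity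
    linarith
  have hRV : R * V1 = 4 * |K| + V1 := by rw [hR, add_mul, one_mul, div_mul_cancel₀ _ hV.ne']
  refine ⟨R, hRpos, ?_⟩
  have hval : ∀ x, ‖par (-1) x‖ ^ 2 = 1 / 4 := fun x => by
    simp only [par, norm_smul, norm_inv, norm_e0, mul_one]; norm_num
  simp only [hval]
  rw [setIntegral_ball_const 0 hRpos]
  have hnn : 0 ≤ R * V1 / 4 * R := by have := hRpos.le; have := hV.le; positivity
  calc K * R ≤ |K| * R := by gcongr; exact le_abs_self K
    _ < (R * V1 / 4) * R := by apply mul_lt_mul_of_pos_right _ hRpos; linarith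
    _ ≤ (R * V1 / 4) * R * R := le_mul_of_one_le_right hnn hR1
    _ = 1 / 4 * (R ^ 3 * V1) := by ring

/-- `A_C` with the Oseen/KNSS mild clause (3) DELETED (smooth ∧ div-free ∧ Type-I only). -/
def IsTypeIAncientNoGauge (C : ℝ) (u : ℝ → ℝ³ → ℝ³) : Prop :=
  ContDiffOn ℝ (⊤ : ℕ∞) (Function.uncurry u) (Iio 0 ×ˢ univ) ∧ (∀ t < 0, VectorCalculus.IsDivFree (u t)) ∧
    HasTypeITimeDecay C u

/-- The crux with clause (3) deleted. -/
def FarPastLedgerWithoutMild : Prop :=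
  ∀ C : ℝ, ∃ K : ℝ, ∀ (u : ℝ → ℝ³ → ℝ³), IsTypeIAncientNoGauge C u → ∀ t < 0, ∀ (x₀ : ℝ³) (R : ℝ), 0 < R →
    ∫ x in ball x₀ R, ‖u t x‖ ^ 2 ≤ K * R

/-- **Clause (3) is load-bearing**: without the Oseen/KNSS gauge the ledger is FALSE (at `C = 1`),
by the parasitic `par` (energy `∝ R³/(−t)`).  So any proof must use the integral equation, i.e.
the PDE and its gauge — as the card says. -/
theorem farPastLedger_false_without_mild : ¬ FarPastLedgerWithoutMild := by
  intro h
  obtain ⟨K, hK⟩ := h 1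
  obtain ⟨R, hR, hlt⟩ := par_energy_gt K
  exact absurd (hK par ⟨par_smooth, fun t _ => par_divFree t, par_typeI⟩ (-1) (by norm_num) 0 R hR)
    (not_le.2 hlt)

/-! ### The Type-I clause (4) and ancientness: constants -/

/-- The constant field `e₀`. -/
def cst : ℝ → ℝ³ → ℝ³ := fun _ _ => e0

/-- Constants are smooth on any set. -/
theorem cst_smooth (S : Set (ℝ × ℝ³)) : ContDiffOn ℝ (⊤ : ℕ∞) (Function.uncurry cst) S :=
  contDiffOn_const

/-- Constants are divergence free. -/
theorem cst_divFree (t : ℝ) : VectorCalculus.IsDivFree (cst t) := fun x => by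
  rw [show cst t = fun _ => (e0 : ℝ³) from rfl]
  simp [VectorCalculus.divergence]

/-- Constants are KNSS-mild between any two times (`e^{σΔ}c = c`, `B(c,c) = 0`: KNSS Rem. 6.1). -/
theorem cst_mild {s t : ℝ} (hst : s < t) (x : ℝ³) :
    cst t x = heatFlow (cst s) (t - s) x - oseenDuhamel 1 s cst cst t x := by
  rw [oseenDuhamel_eq_zero_of_const (u := cst) (v := cst) (b := fun _ => e0) (c := fun _ => e0)
    (fun τ _ y => rfl) (fun τ _ y => rfl), heatFlow_of_pos _ (sub_pos.2 hst), sub_zero]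
  show e0 = heatExtension (fun _ : ℝ³ => e0) (t - s) x
  rw [heatExtension_const _ (sub_pos.2 hst)]

/-- `‖cst t x‖ = 1`. -/
theorem norm_cst (t : ℝ) (x : ℝ³) : ‖cst t x‖ = 1 := norm_e0

/-- Constants have energy `R³V₁` in `B_R`, beating `K·R` for large `R`. -/
theorem cst_energy_gt (K t : ℝ) : ∃ R, 0 < R ∧ K * R < ∫ x in ball (0 : ℝ³) R, ‖cst t x‖ ^ 2 := by
  have hV := V1_pos
  set R : ℝ := |K| / V1 + 1 with hR
  have hRpos : 0 < R := by positivity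
  have hR1 : 1 ≤ R := by
    have : 0 ≤ |K| / V1 := by positivity
    linarith
  have hRV : R * V1 = |K| + V1 := by rw [hR, add_mul, one_mul, div_mul_cancel₀ _ hV.ne']
  refine ⟨R, hRpos, ?_⟩
  have hval : ∀ x, ‖cst t x‖ ^ 2 = 1 := fun x => by rw [norm_cst, one_pow]
  simp only [hval]
  rw [setIntegral_ball_const 0 hRpos, one_mul]
  have hnn : 0 ≤ R * V1 * R := by have := hRpos.le; have := hV.le; positivity
  calc K * R ≤ |K| * R := by gcongr; exact le_abs_self K
    _ < (R * V1) * R := by apply mul_lt_mul_of_pos_right _ hRpos; linarith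
    _ ≤ (R * V1) * R * R := le_mul_of_one_le_right hnn hR1
    _ = R ^ 3 * V1 := by ring

/-- Clause (4) replaced by mere boundedness `‖u‖ ≤ M`: KNSS's bounded ancient mild class (smooth,
div-free, Oseen-mild between all `s < t < 0`, bounded). -/
def IsBoundedAncientMildField (M : ℝ) (u : ℝ → ℝ³ → ℝ³) : Prop :=
  ContDiffOn ℝ (⊤ : ℕ∞) (Function.uncurry u) (Iio 0 ×ˢ univ) ∧ (∀ t < 0, VectorCalculus.IsDivFree (u t)) ∧
    (∀ s t : ℝ, s < t → t < 0 → ∀ x, u t x = heatFlow (u s) (t - s) x - oseenDuhamel 1 s u u t x) ∧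
    ∀ t < 0, ∀ x, ‖u t x‖ ≤ M

/-- The crux with the Type-I rate weakened to boundedness. -/
def FarPastLedgerWithoutTypeI : Prop :=
  ∀ M : ℝ, ∃ K : ℝ, ∀ (u : ℝ → ℝ³ → ℝ³), IsBoundedAncientMildField M u → ∀ t < 0, ∀ (x₀ : ℝ³) (R : ℝ),
    0 < R → ∫ x in ball x₀ R, ‖u t x‖ ^ 2 ≤ K * R

/-- **Clause (4) is load-bearing**: in the bounded ancient mild class the ledger is FALSE
(constants; energy `R³V₁`).  A proof must use the Type-I DECAY at `t → −∞`, not only mildness.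
(Weakening (4) to `‖u(t)‖_∞ → 0` without rate is not cheaply refutable: no nonconstant bounded
ancient mild solution of 3-D NS is known — KNSS Liouville conjecture.) -/
theorem farPastLedger_false_without_typeI : ¬ FarPastLedgerWithoutTypeI := by
  intro h
  obtain ⟨K, hK⟩ := h 1
  obtain ⟨R, hR, hlt⟩ := cst_energy_gt K (-1)
  refine absurd (hK cst ⟨cst_smooth _, fun t _ => cst_divFree t, fun s t hst _ x => cst_mild hst x,
    fun t _ x => (norm_cst t x).le⟩ (-1) (by norm_num) 0 R hR) (not_le.2 hlt)

/-- The class on the FINAL UNIT WINDOW `(−1, 0)` only (ancientness deleted; everything else kept,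
including the Type-I rate on the window). -/
def IsTypeIMildOnUnitWindow (C : ℝ) (u : ℝ → ℝ³ → ℝ³) : Prop :=
  ContDiffOn ℝ (⊤ : ℕ∞) (Function.uncurry u) (Ioo (-1) 0 ×ˢ univ) ∧
    (∀ t ∈ Ioo (-1 : ℝ) 0, VectorCalculus.IsDivFree (u t)) ∧
    (∀ s t : ℝ, -1 < s → s < t → t < 0 → ∀ x, u t x = heatFlow (u s) (t - s) x - oseenDuhamel 1 s u u t x) ∧
    ∀ t ∈ Ioo (-1 : ℝ) 0, ∀ x, ‖u t x‖ ≤ C / Real.sqrt (-t)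

/-- The crux on the final unit window. -/
def FarPastLedgerOnUnitWindow : Prop :=
  ∀ C : ℝ, ∃ K : ℝ, ∀ (u : ℝ → ℝ³ → ℝ³), IsTypeIMildOnUnitWindow C u → ∀ t ∈ Ioo (-1 : ℝ) 0,
    ∀ (x₀ : ℝ³) (R : ℝ), 0 < R → ∫ x in ball x₀ R, ‖u t x‖ ^ 2 ≤ K * R

/-- **Ancientness (the FAR PAST) is load-bearing**: on a final window the ledger is FALSE at
`C = 1` (constants `e₀` obey `1 ≤ 1/√(−t)` on `(−1,0)`).  This is exactly AlbrittonBarker2019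
Rem. 3.2's setting (solutions on `(−1,0)`): there the Type-I rate does not give `𝐈 < ∞`; the crux's
bet is the entry time `−4R²`, which only ancient solutions have. -/
theorem farPastLedger_false_on_window : ¬ FarPastLedgerOnUnitWindow := by
  intro h
  obtain ⟨K, hK⟩ := h 1
  obtain ⟨R, hR, hlt⟩ := cst_energy_gt K (-1 / 2)
  have hmem : IsTypeIMildOnUnitWindow 1 cst := by
    refine ⟨cst_smooth _, fun t _ => cst_divFree t, fun s t _ hst _ x => cst_mild hst x, fun t ht x => ?_⟩
    have hs : 0 < Real.sqrt (-t) := Real.sqrt_pos.2 (by linarith [ht.2])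
    rw [norm_cst, le_div_iff₀ hs, one_mul]
    calc Real.sqrt (-t) ≤ Real.sqrt 1 := Real.sqrt_le_sqrt (by linarith [ht.1])
      _ = 1 := Real.sqrt_one
  exact absurd (hK cst hmem (-1 / 2) ⟨by norm_num, by norm_num⟩ 0 R hR) (not_le.2 hlt)

end Summit.NavierStokesRegularity.NavierStokesRegularity.Theorems.FarPastLedger.Negative
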